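import Summits.RiemannHypothesis.RiemannHypothesis.Theorems.TiltedLandingLaw421R3Lens1CoverageB
import Summits.RiemannHypothesis.RiemannHypothesis.Theorems.TiltedLandingLaw421R3RateSplit
import Summits.RiemannHypothesis.RiemannHypothesis.Theses.EarlyAppointments

/-! # trkD_v7q (half) — skeleton for `TiltedLandingLaw421R` at `halfPurse`: the SUCC law of record `RhW08.LandingDoor.DoorAvailLawQ8`
split into REGIMES (lens-1 coverage theorem v2 e87959b0c0079a43, director (CA446)/(CA447)): regimes F, N♭ and L-deep are THEOREMS
(`regime_F`, `regime_Nb`, `regime_Ldeep` — the last by the Jensen dip sign lemma `jensenDip_pos` / `succ_of_dip_deep`), the open regimes are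
the stubs `RegCov8` (covered: a roof zero over `v`), `RegLedge8` (landing dip in the EDGE layer `|xs − x₀| > R/2 − Hs`, no certificate),
`RegE8` (else ⁄ grazing); RATE stub unchanged (`RhW08.RateSplit.RateLawsHalfQ`, #1112).  Each SUCC stub is strictly weaker than v6q's
`stub_doorAvailLawQ8` (`doorAvailLawQ8_implies_regimes`, `regLedge8_of_regL8`).  This draft SUPERSEDES `trkD_v7q-DRAFT.lean` c1ce25a9880a3c9b
(which carried `stub_regL8`; withdrawn unregistered — lens-1's §15 label «v8q» in Coverage-v2 = THIS registry v7q).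
PRECONDITION: registered only after BOTH `…/Theorems/TiltedLandingLaw421R3Lens1Coverage.lean` (= lens-1 `Coverage-landable-v1A.lean`
3818338129bd7bdb · 1369 l) and `…/Theorems/TiltedLandingLaw421R3Lens1CoverageB.lean` (= `Coverage-landable-v1B.lean` fe77b85be55218e9 · 309 l; declares
`RegCov8`/`RegLedge8`/`RegE8` and `TiltedLandingLaw421R_of_regimes2`, ns `RhW08.Lens1Coverage`, 0 sorry) have LANDED (director (CA448), packaging (ii));
this draft supersedes DRAFT-2 0f7060bd222deea4 (single-file import) and DRAFT c1ce25a9 (`stub_regL8`).  Replace `RhW08.Lens1Coverage.` below by the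
landed namespace if the desk renames it. -/

namespace Summit.RiemannHypothesis.RiemannHypothesis.Cruxes.TiltedLandingLaw421R.TrkDV7Q

set_option linter.dupNamespace false

theorem stub_regCov8 : RhW08.Lens1Coverage.RegCov8 := by
  sorry

theorem stub_regLedge8 : RhW08.Lens1Coverage.RegLedge8 := by
  sorry

theorem stub_regE8 : RhW08.Lens1Coverage.RegE8 := by
  sorry

theorem stub_rateLawsHalfQ : RhW08.RateSplit.RateLawsHalfQ := by
  sorry

theorem TiltedLandingLaw421R_of : Summit.RiemannHypothesis.RiemannHypothesis.Theses.EarlyAppointments.TiltedLandingLaw421R :=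
  RhW08.Lens1Coverage.TiltedLandingLaw421R_of_regimes2 stub_regCov8 stub_regLedge8 stub_regE8 stub_rateLawsHalfQ

end Summit.RiemannHypothesis.RiemannHypothesis.Cruxes.TiltedLandingLaw421R.TrkDV7Q
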